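import Literature.NumberTheory.PAdicHodge.BdRPlusFormalLogThetaKernel
import Literature.NumberTheory.PAdicHodge.BdRPlusFormalLogModFil
import Mathlib.RingTheory.Localization.FractionRing
import HarnessLib

/-!
# The `[p]`-division tower of Fontaine's canonical lifts: shift = `p •`, uniform `(p, ξ)`-nilpotence, and the numerators of `log_W` in a fraction field

Topic `Literature/NumberTheory/PAdicHodge`; namespace `Literature.NumberTheory.PAdicHodge.AinfTop`. THEOREMS ONLY (no definition, no named fact, no
instance, no `sorry`). `𝔸_inf`-side inputs for instantiating `Literature.RingTheory.FormalGroups.PadicLogSeries.frobenius_honda_eq_zero_of_tower` /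
`logSum_eq_nsmul_of_tower` at the canonical lifts `[ũ⁽ⁿ⁾] = divisionLiftPt W hθ (u (n + ·))` of the shifts of a `[p]_W`-division sequence `u` in
`Ŵ(𝔪_{ℂ_F})` (φ-road of line `kato_lever`, crux K★ `stmt-BirchSwinnertonDyer-22226`, memo `Lines/kato-lever-K2-phi-road.md`):

* (`[ũ⁽ⁿ⁾] = p • [ũ⁽ⁿ⁺¹⁾]` in `Ŵ(𝔫)` is `BdRPlusFormalLogThetaKernel`'s `divisionLiftPt_val_nsmul_pt` with `mulPC_shift`; not restated here);
* `pow_coe_val_nsmul_divisionLiftPt_mem` — **uniform nilpotence**: if `‖u₀‖^N ≤ ‖p‖` then `((k • [ũ]).val)^N ∈ (p, ξ)` for EVERY `k`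
  (`‖θ(k • [ũ])‖ ≤ ‖u₀‖`, `norm_thetaPt_nsmul_le`);
* `algebraMap_padicInt_of_norm_le_eq_ratCast` — a `p`-integral rational `r` read in any characteristic-`0` field over a `ℤ_p`-algebra is `r`;
  hence `algebraMap_formalLogNum_eq` — the numerators `formalLogNum W p` satisfy the hypothesis `hbf` of `PadicLogTypeSeriesAdd`
  (`ι(b_m) = m · coeff_m log_W` in the fraction field).

Infrastructure only; BSD / K★ are not proved by any of this.

## References
* J.-M. Fontaine, *Le corps des périodes p-adiques*, Astérisque 223 (1994), Exp. II §1.2–1.3. [FontaineAsterisque223III]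
* J. H. Silverman, *The Arithmetic of Elliptic Curves* (2009), IV.2.3, IV.5.5. [SilvermanAEC2009]
-/

noncomputable section

open Ideal Filter Topology WittVector MvPowerSeries ValuativeRel Field

namespace Literature.NumberTheory.PAdicHodge

/-! ## §1 `p`-integral rationals in `ℤ_p`-algebras -/

/-- **A `p`-integral rational is itself in every characteristic-`0` field over a `ℤ_p`-algebra**: for `r ∈ ℚ` with `‖r‖_p ≤ 1`, `ι : ℤ_p → B`,
`B → K` a field of characteristic `0`: `algebraMap B K (ι ⟨r, _⟩) = r`. [cite: SilvermanAEC2009, IV.5.5] -/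
theorem algebraMap_padicInt_of_norm_le_eq_ratCast {p : ℕ} [Fact p.Prime] {B K : Type*} [CommRing B] [Field K] [CharZero K] [Algebra B K]
    (ι : ℤ_[p] →+* B) (r : ℚ) (hr : ‖(r : ℚ_[p])‖ ≤ 1) :
    algebraMap B K (ι ⟨(r : ℚ_[p]), hr⟩) = (r : K) := by
  have hden : (r.den : K) ≠ 0 := Nat.cast_ne_zero.2 r.den_ne_zero
  have key : ((r.den : ℕ) : ℤ_[p]) * ⟨(r : ℚ_[p]), hr⟩ = (r.num : ℤ_[p]) := by
    apply Subtype.ext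
    push_cast
    rw [mul_comm]
    exact_mod_cast Rat.mul_den_eq_num r
  have h := congrArg (fun t : ℤ_[p] => algebraMap B K (ι t)) key
  simp only [map_mul, map_natCast, map_intCast] at h
  conv_rhs => rw [Rat.cast_def]
  rw [eq_div_iff hden, mul_comm, h]

/-- **The numerators of `log_W` in a fraction field**: for `W/ℤ`, `b = formalLogNum W p` (`b_m = m · coeff_m log_W ∈ ℤ_p`), any `ι : ℤ_p → B` into a
domain of characteristic `0` and its fraction field `K`: `algebraMap B K (ι (b m)) = m · algebraMap ℚ K (coeff_m log_{W/ℚ})` — hypothesis `hbf` of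
`PadicLogSeries.logSum_eq_add_of_forall_sub_aeval_mem`. [cite: SilvermanAEC2009, IV.5.5] -/
theorem algebraMap_formalLogNum_eq {p : ℕ} [Fact p.Prime] (W : WeierstrassCurve ℤ) {B K : Type*} [CommRing B] [Field K] [CharZero K]
    [Algebra B K] [Algebra ℚ K] (ι : ℤ_[p] →+* B) (m : ℕ) :
    algebraMap B K (ι (GaloisContinuity.formalLogNum W p m)) =
      (m : K) * algebraMap ℚ K (PowerSeries.coeff m (W.map (Int.castRingHom ℚ)).formalLog) := by
  set c : ℚ := PowerSeries.coeff m (W.map (Int.castRingHom ℚ)).formalLog with hc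
  have hval : ((GaloisContinuity.formalLogNum W p m : ℤ_[p]) : ℚ_[p]) = (((m : ℚ) * c : ℚ) : ℚ_[p]) := by
    have hmap : (W.map (Int.castRingHom ℚ)).map (algebraMap ℚ ℚ_[p]) = W.map (Int.castRingHom ℚ_[p]) := by
      rw [WeierstrassCurve.map_map]; congr 1
    change (m : ℚ_[p]) * PowerSeries.coeff m (W.map (Int.castRingHom ℚ_[p])).formalLog = _
    rw [← hmap, ← WeierstrassCurve.map_formalLog, PowerSeries.coeff_map, Rat.cast_mul, Rat.cast_natCast]
    rfl
  have hr : ‖(((m : ℚ) * c : ℚ) : ℚ_[p])‖ ≤ 1 := by rw [← hval]; exact (GaloisContinuity.formalLogNum W p m).2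
  have heq : GaloisContinuity.formalLogNum W p m = ⟨(((m : ℚ) * c : ℚ) : ℚ_[p]), hr⟩ := Subtype.ext hval
  rw [heq, algebraMap_padicInt_of_norm_le_eq_ratCast ι _ hr, Rat.cast_mul, Rat.cast_natCast, eq_ratCast (algebraMap ℚ K) c]

/-! ## §2 The tower of canonical lifts: `[ũ⁽ⁿ⁾] = p • [ũ⁽ⁿ⁺¹⁾]` and uniform `(p, ξ)`-nilpotence -/

namespace AinfTop

open Literature.NumberTheory.GaloisRepresentations Literature.NumberTheory.GaloisRepresentations.IsNonarchimedeanLocalField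
open Literature.NumberTheory.GaloisRepresentations.LubinTate Literature.NumberTheory.EllipticCurves

variable {F : Type} [Field F] [ValuativeRel F] [TopologicalSpace F] [IsNonarchimedeanLocalField F]
  [CharZero F] {p : ℕ} [Fact p.Prime] [Fact (¬ IsUnit (p : integerC F))]
  [IsAdicComplete (Ideal.span {(p : integerC F)}) (integerC F)]
  {hθ : Function.Surjective (fontaineTheta (integerC F) p)} (W : WeierstrassCurve ℤ)

omit [CharZero F] [Fact p.Prime] [Fact (¬ IsUnit (p : integerC F))] [IsAdicComplete (Ideal.span {(p : integerC F)}) (integerC F)] in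
/-- Shifting a `[p]`-division sequence. [cite: SilvermanAEC2009, IV.2.3] -/
theorem mulPC_shift {u : ℕ → (maxNilIdealC F).toIdeal} (hup : ∀ n, mulPC F p W (u (n + 1)) = u n) (m : ℕ) :
    ∀ n, mulPC F p W (u (m + (n + 1))) = u (m + n) := fun n => hup (m + n)

/-- ★ **Uniform `(p, ξ)`-nilpotence along the iterates `k • [ũ]`**: if `‖u₀‖^N ≤ ‖p‖` then `((k • [ũ]).val)^N ∈ (p, ξ)` for every `k`
(`θ((k•[ũ]).val) = (k • u)_0` has norm `≤ ‖u₀‖`; `(p, ξ) = θ⁻¹(p𝒪_{ℂ_F})`). [cite: FontaineAsterisque223III, Exp. II §1.3] -/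
theorem pow_coe_val_nsmul_divisionLiftPt_mem {u : ℕ → (maxNilIdealC F).toIdeal} (hup : ∀ n, mulPC F p W (u (n + 1)) = u n) {N : ℕ}
    (hN : ‖(((u 0 : (maxNilIdealC F).toIdeal) : CBall F) : CompletedAlgClosure F)‖ ^ N ≤ ‖(p : CompletedAlgClosure F)‖) (k : ℕ) :
    (((k • divisionLiftPt W hθ u hup).val : (nilTheta F p hθ).toIdeal) : AinfTop F p) ^ N ∈ (WithIdeal.i : Ideal (AinfTop F p)) := by
  set Q := divisionLiftPt W hθ u hup with hQ
  -- `‖θ((k•Q).val)‖ ≤ ‖u 0‖`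
  have h1 : ‖(((thetaPt W hθ (k • Q)).val : CBall F) : CompletedAlgClosure F)‖ ≤
      ‖(((u 0 : (maxNilIdealC F).toIdeal) : CBall F) : CompletedAlgClosure F)‖ := by
    have h := GaloisContinuity.norm_thetaPt_nsmul_le W Q k
    rwa [hQ, thetaPt_divisionLiftPt] at h
  -- hence `θ(((k•Q).val))^N ∈ p𝒪`
  have hp0 : ((p : integerC F) : CompletedAlgClosure F) ≠ 0 := by
    rw [coe_natCast_integerC]; exact natCast_C_ne_zero (Fact.out : p.Prime).ne_zero
  have h2 : fontaineTheta (integerC F) p ((of F p).symm (((k • Q).val : (nilTheta F p hθ).toIdeal) : AinfTop F p)) ^ N ∈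
      Ideal.span {(p : integerC F)} := by
    rw [← pow_one (Ideal.span {(p : integerC F)}), mem_span_pow_iff hp0 1, pow_one, Subring.coe_pow, norm_pow, coe_natCast_integerC]
    have hθeq : ((fontaineTheta (integerC F) p ((of F p).symm (((k • Q).val : (nilTheta F p hθ).toIdeal) : AinfTop F p)) : integerC F) :
        CompletedAlgClosure F) = (((thetaPt W hθ (k • Q)).val : CBall F) : CompletedAlgClosure F) := by
      rw [coe_val_thetaPt, ← coe_theta]; rfl
    rw [hθeq]
    exact (pow_le_pow_left₀ (norm_nonneg _) h1 N).trans hN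
  exact pow_mem_span_p_xi_of_fontaineTheta_pow_mem hθ h2

end AinfTop

end Literature.NumberTheory.PAdicHodge

end
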